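import Literature.Topology.FourManifolds.SliceDiscInTransport
import Literature.Topology.FourManifolds.HomotopyS4Freedman
import Literature.Topology.FourManifolds.OrientedConnectedSumTransportProofs
import Literature.Topology.FourManifolds.OrientedConnectedSumAssoc
import Literature.Topology.FourManifolds.ConnectedSumProofs
import Literature.Topology.FourManifolds.ConnectedSum
import Literature.Topology.FourManifolds.SPC4Wave0
import Literature.AlgebraicTopology.SingularHomology.AttachedCellConcentration
import HarnessLib

/-!
# Stub `stub_sliceDiscIn_transport_puncture` of line `embed-dont-dissolve` for crux
`ZeroSurgeryExotic.ZseSVanishesOnPairs` (item stmt-SmoothPoincare4-0368, route route-SmoothPoincare4-ZeroSurgeryExotic)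

**Transport of slice data through a punctured embedding.**  Let `K` be slice in a closed smooth
homotopy 4-sphere `X` with respect to data `(e, f)` (`Knot.IsSliceDiscIn`, Manolescu–Piccirillo
2023, Def. 2.1: a smooth ball `e : ℝ⁴ ↪ X` and a smooth proper disc `f|_{𝔻²}` in `X ∖ e(B̊⁴)`
bounded by `e ∘ K`), with `e` orientation preserving from the standard `ℝ⁴` to `(X, oX)`, let
`q ∉ e(ℝ⁴) ∪ f(ℝ²)`, and let `j : X ∖ {q} ↪ P` be an orientation-preserving smooth embedding into a
smooth oriented 4-manifold `(P, oP)`.  Then `K` is slice in `P` with respect to the pushed data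
`(e', f') = (j ∘ e, j ∘ f)` (corestricted to `X ∖ {q}` first), the ball `e'` is orientation
preserving into `(P, oP)`, and `e'`, `f'` take values in the open set `U = j(X ∖ {q}) ≅ X ∖ {q}`,
whose second integral homology vanishes.

Route (tree theorems only):
* slice data: `Knot.IsSliceDiscIn.codRestrict` (to the open submanifold `X ∖ {q}`) and
  `Knot.IsSliceDiscIn.comp_isSmoothEmbedding` (along `j`), `SliceDiscInTransport.lean`;
* orientation: `isOrientationPreserving_comp_codRestrict` (`OrientedConnectedSumAssoc.lean`: the
  composite of an orientation-preserving open embedding, corestricted to an open submanifold, with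
  an orientation-preserving open embedding of that submanifold is orientation preserving; chain
  rule with invertible Jacobians), the ranges being open by invariance of domain
  (`isOpen_range_of_isSmoothEmbedding_disc`, `isOpen_range_of_isImmersion_of_finrank_le`);
* homology: `H₂(X ∖ {q}; ℤ) = 0` for a punctured homotopy 4-sphere
  (`isZero_singularHomology_two_compl_singleton_of_homotopyEquiv_sphere_four`,
  `HomotopyS4Freedman.lean`, Mayer–Vietoris), moved along the homeomorphism `X ∖ {q} ≃ₜ j(X ∖ {q})`
  (`singularHomology.isZero_of_homeomorph`); the glue `singularHomologyZ` of `SPC4Wave0.lean` is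
  Mathlib's singular homology functor with `ULift ℤ` coefficients, definitionally the tree's
  `Literature.AlgebraicTopology.SingularHomology.singularHomology ℤ ℤ`.

This is the registered stub `stub_sliceDiscIn_transport_puncture` (stub 2, def-free) of the checked
skeleton of the line; it is the bookkeeping behind "if a knot is slice in `X`, it is H-slice in
any `W ⊇ X ∖ pt`" (Manolescu–Piccirillo 2023, §2, remark after Def. 2.1).
-/

noncomputable section

-- the prescribed namespace `Summit.<P>.<Sub>.…` duplicates `SmoothPoincare4` (P = Sub)
set_option linter.dupNamespace false

open scoped Manifold ContDiff Topology
open Set Function ContinuousMap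
open Literature.Topology.FourManifolds

namespace Summit.SmoothPoincare4.SmoothPoincare4.Theorems.ZseSVanishesOnPairs

/-- Local notation: the model space `ℝⁿ`. -/
local notation "𝔼 " n:arg => EuclideanSpace ℝ (Fin n)
/-- Local notation: the round 4-sphere. -/
local notation "𝕊⁴" => (Metric.sphere (0 : EuclideanSpace ℝ (Fin 5)) 1)

/-- **Transport of slice data through a punctured orientation-preserving embedding.**  If `K` is
slice in a closed homotopy 4-sphere `X` with respect to `(e, f)`, `e` orientation preserving for
`oX`, `q ∉ e(ℝ⁴) ∪ f(ℝ²)`, and `j : X ∖ {q} ↪ P` is an orientation-preserving smooth embedding into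
a smooth 4-manifold `(P, oP)`, then `K` is slice in `P` with respect to data
`(e', f') = (j ∘ e, j ∘ f)` (corestricted), `e'` is orientation preserving into `(P, oP)`, and
`e', f'` take values in an open `U ⊆ P` (namely `U = range j ≅ X ∖ {q}`) with `H₂(U; ℤ) = 0`
(Manolescu–Piccirillo 2023, Def. 2.1 and the remark of §2 that sliceness in `X°` only sees `X`
minus a point; `H₂` of the punctured homotopy sphere by Mayer–Vietoris, Hatcher §2.2).
[cite: ManolescuPiccirillo2023, Def. 2.1 and §2] -/
theorem stub_sliceDiscIn_transport_puncture :
    ∀ (K : Knot) (X : Type) [TopologicalSpace X] [T2Space X] [SecondCountableTopology X] [ChartedSpace (𝔼 4) X]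
      [IsManifold (𝓡 4) ∞ X] [CompactSpace X] (oX : SmoothOrientation (𝓡 4) X) (e : 𝔼 4 → X) (f : 𝔼 2 → X) (q : X),
      Nonempty (X ≃ₕ 𝕊⁴) → K.IsSliceDiscIn X e f → IsOrientationPreserving (SmoothOrientation.euclidean 4) oX e →
      q ∉ range e → q ∉ range f →
      ∀ (P : Type) [TopologicalSpace P] [T2Space P] [SecondCountableTopology P] [ChartedSpace (𝔼 4) P]
        [IsManifold (𝓡 4) ∞ P] (oP : SmoothOrientation (𝓡 4) P)
        (j : ↥((⟨{q}ᶜ, isOpen_compl_singleton⟩ : TopologicalSpace.Opens X)) → P),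
        Manifold.IsSmoothEmbedding (𝓡 4) (𝓡 4) ∞ j →
        IsOrientationPreserving (oX.restrict (⟨{q}ᶜ, isOpen_compl_singleton⟩ : TopologicalSpace.Opens X)) oP j →
        ∃ (e' : 𝔼 4 → P) (f' : 𝔼 2 → P), K.IsSliceDiscIn P e' f' ∧
          IsOrientationPreserving (SmoothOrientation.euclidean 4) oP e' ∧
          ∃ U : TopologicalSpace.Opens P, (∀ v, e' v ∈ U) ∧ (∀ y, f' y ∈ U) ∧
            CategoryTheory.Limits.IsZero (singularHomologyZ (↥U) 2) := by
  intro K X _ _ _ _ _ _ oX e f q hX hef he hq hqf P _ _ _ _ _ oP j hj hjo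
  -- the ball and the disc lie in the open submanifold `X ∖ {q}`
  have heU : ∀ v, e v ∈ ((⟨{q}ᶜ, isOpen_compl_singleton⟩ : TopologicalSpace.Opens X)) :=
    fun v hv => hq ⟨v, hv⟩
  have hfU : ∀ y, f y ∈ ((⟨{q}ᶜ, isOpen_compl_singleton⟩ : TopologicalSpace.Opens X)) :=
    fun y hy => hqf ⟨y, hy⟩
  -- (i) slice data: corestrict to `X ∖ {q}`, push along `j`
  have h1 := (hef.codRestrict _ heU hfU).comp_isSmoothEmbedding hj
  -- invariance of domain: the ranges of `e` and `j` are open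
  have heo : IsOpen (range e) := isOpen_range_of_isSmoothEmbedding_disc hef.isSmoothEmbedding
  have hjopen : IsOpen (range j) :=
    isOpen_range_of_isImmersion_of_finrank_le hj.isImmersion le_rfl
  -- (ii) orientation: chain rule through the open submanifold `X ∖ {q}`
  have h2 : IsOrientationPreserving (SmoothOrientation.euclidean 4) oP
      (j ∘ fun v => (⟨e v, heU v⟩ :
        ↥((⟨{q}ᶜ, isOpen_compl_singleton⟩ : TopologicalSpace.Opens X)))) :=
    isOrientationPreserving_comp_codRestrict hef.isSmoothEmbedding heo heU hj hjopen
      (fun _ => rfl) he hjo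
  refine ⟨_, _, h1, h2, ⟨range j, hjopen⟩, fun v => ⟨_, rfl⟩, fun y => ⟨_, rfl⟩, ?_⟩
  -- (iii) `H₂(range j; ℤ) ≅ H₂(X ∖ {q}; ℤ) = 0`
  have h0 : CategoryTheory.Limits.IsZero
      (Literature.AlgebraicTopology.SingularHomology.singularHomology ℤ ℤ
        (↥((⟨{q}ᶜ, isOpen_compl_singleton⟩ : TopologicalSpace.Opens X))) 2) :=
    isZero_singularHomology_two_compl_singleton_of_homotopyEquiv_sphere_four X hX.some q
  have h3 : CategoryTheory.Limits.IsZero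
      (Literature.AlgebraicTopology.SingularHomology.singularHomology ℤ ℤ (↥(range j)) 2) :=
    Literature.AlgebraicTopology.SingularHomology.singularHomology.isZero_of_homeomorph ℤ ℤ
      hj.isEmbedding.toHomeomorph h0
  change CategoryTheory.Limits.IsZero
    (Literature.AlgebraicTopology.SingularHomology.singularHomology ℤ ℤ (↥(range j)) 2)
  exact h3

end Summit.SmoothPoincare4.SmoothPoincare4.Theorems.ZseSVanishesOnPairs

end
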